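import Literature.MathematicalPhysics.QuantumFieldTheory.Balaban1983to89.B11Thm1ExistsUniqueTokensGB
import Literature.MathematicalPhysics.QuantumFieldTheory.Balaban1983to89.B11Thm1ExistsUniqueInductionGBridges

/-!
# `Balaban1983to89.B11Thm1ExistsUniqueTokensGBBridges` — [Balaban1985Variational] = «[15]», Theorem 1 p. 279 (existence ∕ uniqueness half), (11)–(14), Prop. 2: THE PROVED
# BRIDGES, REDUCTIONS AND PRINT's k-INDUCTION for the (E∕U) named fact and its step ∕ supply ∕ lift tokens OVER A BOND DATUM AND A TOP-DATA PREDICATE `(bd, Dat)` — the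
# THEOREMS-ONLY companion of the statement-only module `B11Thm1ExistsUniqueTokensGB` (the `(bd, Dat)` twins of `B11Thm1ExistsUniqueCoP7MGBridges`,
# `B11Thm1ExistsUniqueStepTokensGBridges` and `B11Thm1ExistsUniqueInductionGBridges` §2, proofs verbatim with `IsMinimizerB ∕ AgreeOnB ∕ Dat` for `IsMinimizer ∕ AgreeOn ∕ DataSmall7PTop`)

Honest framing: statement-level skeleton of published theorems with citation tags; proofs where landed; nothing here is a claim about the Yang–Mills mass gap.  Cell `pub-ymgap`
(HUMAN RULINGS D-0062 ∕ D-0149), lane `pub-ymgap-dag-n12-c` g34 (R134 seat (a), N12 = [B15], s1); `--kind proof --supports` K1⁹ `stmt-QuantumFields-27364`; count-neutral; N12 NOT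
discharged; finite 𝕋⁴ at fixed ε; nothing continuum ∕ ℝ⁴ ∕ OS ∕ mass-gap ∕ Clay.  THEOREMS ONLY (no `def`, no `sorry`, no `axiom`, no `instance`): compositions BY NAME between named
`Prop`s NONE of which is produced in the tree, plus elementary bookkeeping.

HONESTY GUARD (director-ym №338 (5)).  PURELY ADDITIVE: the (b)-instance theorems of `B11Thm1ExistsUniqueCoP7MGBridges` ∕ `B11Thm1ExistsUniqueStepTokensGBridges` ∕
`B11Thm1ExistsUniqueInductionGBridges` stay landed and true on their own text; nothing there is edited; the theorems below are their print-datum parametrisations (FLAG №16 ∕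
LOCATE-HSEAM 5d3298b8d191f169), each specialising to the old one at `(Node00.genSetDatum F, Node00.dataSmall7PTopOf F N)` through the `Iff.rfl`s of the statement module.

CONTENTS.
* §1 (14) over `𝔅`: accessors `ApproxMinTopB.plaq ∕ .coDiv ∕ .agree`, `.of_le` (monotone in the thresholds), `.anti` (antitone in the bond datum: agreement on more bonds gives
  agreement on fewer), `approxMinTopB_of_reg` («regular + agreeing ⇒ approximate minimiser»), `approxMinTopB_lamBondsSeq_of_genSet` (a (b)-approximate minimiser is a print-datum one).
* §2 ★★ `variationalThm1EUSepTop7MGB_of_step_of_approxExists` ∕ `…CoP7MGB…` (NAME ⇐ STEP ∧ SUPPLY, pointwise); ★ `approxMinimiserExistsTop7MGB_of_eu_of_reg` ∕ `…CoP7MGB…` (SUPPLY at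
  `C₁ ≥ 1` ⇐ NAME ∧ K0's S1a-C (R)-name `Node00.VariationalThm1RegSepTop7MGB` at the same `(bd, Dat)`); ★ `…_iff_approxExists_of_step_of_reg` (MODULO STEP and (R), NAME ⟺ SUPPLY);
  bookkeeping `.of_le` (ceilings), `.of_imp` (guard), `.of_imp_dat` (data predicate; the name, the step and the supply are ANTITONE in `Dat` — the door for §7′-type bridges
  `Dat′ ⇒ Dat`), `.of_C₁_le` ∕ `.mono` (the constant `C₁`), for the name and the two one-length tokens, `Top` and `CoP`.
* §3 ★★★ `variationalThm1EUSepTop7MGB_of_step_of_reg_of_base_of_lift` ∕ `…CoP7MGB…`: PRINT's k-INDUCTION OVER `(bd, Dat)` — the (E∕U) name from the STEP token, K0's (R)-name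
  over `(bd, Dat)`, the SUPPLY token under the guard `Adm ∧ (k = 1)`, the LIFT token and truncation-stability of the guard; proof = `B11Thm1ExistsUniqueInductionGBridges`' verbatim
  (length `1`: supply ⇒ step; length `k+1 ≥ 2`: lift ⇒ IH at `(truncSeq s, V₀, ε₀′, δ′)` ⇒ (R) ⇒ (13) ⇒ step); `…floorGuard…` (K0's floor guard is truncation-stable for free);
  the lift token's bookkeeping `.of_imp` ∕ `.mono`.
WHAT A CONSUMER DOES WITH IT.  N12's junction re-key (dag-n12-d) reads `VariationalThm1EUSepCoP7MGB F 2 Adm bd Dat B₃ a₀ a₁` at the instance the K0 road produces after Stage 3; an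
(E∕U) producer item is filed against `VariationalThm1EUStepCoP7MGB F 2 A‴ (lamDatum F) (dataSmall7LamTopOf F 2) C₁ B₃ a₀ a₁` at `C₁ := 2·(F.L)^3` (per-scale currency) plus the
length-1 supply and the lift at print's datum, and §3 assembles the name — exactly as for the (b)-instance (the lane's memo `N12-EU-PRODUCER-SHAPE-2026-08-30.md`, items (I-1)–(I-3)).

HONEST SCOPE.  By-name reductions and one induction between named `Prop`s + elementary bookkeeping; nothing of Bałaban's analysis asserted or proved; count-neutral; K0⁷ ∕ K1⁹ NOT
closed; N12 NOT discharged; the Yang–Mills mass gap (Clay) is NOT proved by any of this.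

References: [15] Thm 1 (8) p.279, (11) p.279, (12)–(14) p.280, Prop. 2 p.281, (141)–(142) p.299; [6] = [Balaban1985RegularSpaces] (1.3)–(1.9) p.77; [II] =
[Balaban1984PropagatorsII] (2.3) p.224; [III] = [Balaban1988Convergent] (2.1) p.254, (2.10)–(2.12) p.256, (2.18) p.257; [I] = [Balaban1987RG1] (0.1) p.251, (1.1) p.260.
-/

noncomputable section

namespace Literature.MathematicalPhysics.QuantumFieldTheory.Balaban1983to89.B11Thm1ExistsUniqueTokensGB

open T4Continuum B15DeterminingSets B15DeterminingSetsB GaugeField Node00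
open B16Sect1Backgrounds (toMS)
open B11Thm1ExistsUniqueInductionG (truncSeq seqSeparated_truncSeq floorGuard_truncSeq)

/-! ## §1  (14) over a bond datum: accessors, monotonicity, «regular + agreeing ⇒ approximate minimiser» -/

section Approx

variable {P : Params} {N : ℕ} [NeZero N]

/-- `0 ≤ η_n` on the lattices of record. [cite: Balaban1987RG1, (1.1) p.260 (bookkeeping)] -/
private theorem eta_nonneg' (P : Params) (n : ℕ) : 0 ≤ P.eta n := by
  unfold Params.eta
  exact pow_nonneg (inv_nonneg.mpr (Nat.cast_nonneg _)) n

namespace ApproxMinTopB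

variable {av : ∀ j, Averaging P j (SU N)} {Ω : ℕ → Set (Site P 0)} {Ω₀ : Set (Site P 0)} {k : ℕ} {ρ ρ' : ℕ → ℝ} {𝔅 𝔅' : BDetSet P} {W : MSField P (SU N)}
  {U₀ : GaugeField P 0 (SU N)}

/-- The plaquette clause of (14). [cite: Balaban1985Variational, (14) p.280 (bookkeeping)] -/
theorem plaq (h : ApproxMinTopB av Ω Ω₀ k ρ 𝔅 W U₀) {n : ℕ} (hn : n ≤ k) : PlaqSmallOn (Sect2.omegaPlaqsTop Ω Ω₀ n) (ρ n * P.eta n ^ 2) U₀ := h.1 n hn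

/-- The co-divergence clause of (14). [cite: Balaban1985Variational, (14) p.280 (bookkeeping)] -/
theorem coDiv (h : ApproxMinTopB av Ω Ω₀ k ρ 𝔅 W U₀) {n : ℕ} (hn : n ≤ k) : Sect2.CoDivSmallOn (Sect2.omegaBondsTop Ω Ω₀ n) (ρ n * P.eta n ^ 3) U₀ := h.2.1 n hn

/-- The agreement clause of (14), on the bonds of `𝔅`. [cite: Balaban1985Variational, (14) p.280; Balaban1988Convergent, (2.10) p.256 (bookkeeping)] -/
theorem agree (h : ApproxMinTopB av Ω Ω₀ k ρ 𝔅 W U₀) : AgreeOnB 𝔅 (avgFamily av U₀) W := h.2.2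

/-- (14) is MONOTONE in the regularity thresholds. [cite: Balaban1985Variational, (14) p.280 (bookkeeping)] -/
theorem of_le (h : ApproxMinTopB av Ω Ω₀ k ρ 𝔅 W U₀) (hρ : ∀ n, n ≤ k → ρ n ≤ ρ' n) : ApproxMinTopB av Ω Ω₀ k ρ' 𝔅 W U₀ := by
  refine ⟨fun n hn p hp => (h.1 n hn p hp).trans_le ?_, fun n hn => (h.2.1 n hn).of_le ?_, h.2.2⟩
  · exact mul_le_mul_of_nonneg_right (hρ n hn) (pow_nonneg (eta_nonneg' P n) 2)
  · exact mul_le_mul_of_nonneg_right (hρ n hn) (pow_nonneg (eta_nonneg' P n) 3)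

/-- (14) is ANTITONE in the bond datum: agreement on more bonds gives agreement on fewer (F0a `AgreeOnB.anti`). [cite: Balaban1985Variational, (14) p.280; Balaban1988Convergent, (2.10) p.256 (bookkeeping)] -/
theorem anti (h : ApproxMinTopB av Ω Ω₀ k ρ 𝔅 W U₀) (h𝔅 : ∀ j, 𝔅' j ⊆ 𝔅 j) : ApproxMinTopB av Ω Ω₀ k ρ 𝔅' W U₀ :=
  ⟨h.1, h.2.1, h.2.2.anti h𝔅⟩

end ApproxMinTopB

/-- **A REGULAR AGREEING CONFIGURATION IS AN APPROXIMATE MINIMISER**: a configuration agreeing with `W` on `𝔅` and `B₃δ_n`-regular in the sense of (8) satisfies (14) over `𝔅` at every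
`ρ_n ≥ B₃δ_n`. [cite: Balaban1985Variational, Thm 1 (8) p.279, (14) p.280] -/
theorem approxMinTopB_of_reg {av : ∀ j, Averaging P j (SU N)} {Ω : ℕ → Set (Site P 0)} {Ω₀ : Set (Site P 0)} {k : ℕ} {B₃ : ℝ} {δ ρ : ℕ → ℝ} {𝔅 : BDetSet P}
    {W : MSField P (SU N)} {U₀ : GaugeField P 0 (SU N)} (hagree : AgreeOnB 𝔅 (avgFamily av U₀) W)
    (h8 : (∀ n, n ≤ k → PlaqSmallOn (Sect2.omegaPlaqsTop Ω Ω₀ n) (B₃ * δ n * P.eta n ^ 2) U₀) ∧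
      ∀ n, n ≤ k → Sect2.CoDivSmallOn (Sect2.omegaBondsTop Ω Ω₀ n) (B₃ * δ n * P.eta n ^ 3) U₀)
    (hρ : ∀ n, n ≤ k → B₃ * δ n ≤ ρ n) : ApproxMinTopB av Ω Ω₀ k ρ 𝔅 W U₀ :=
  ApproxMinTopB.of_le (ρ := fun n => B₃ * δ n) ⟨h8.1, h8.2, hagree⟩ hρ

/-- **A (b)-APPROXIMATE MINIMISER IS A PRINT-DATUM APPROXIMATE MINIMISER**: (14) with agreement on the bonds MEETING the determining set (`B11Thm1ExistsUniqueStepTokensG.ApproxMinTop`)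
implies (14) with agreement on print's [II] (2.3) datum `lamBondsSeq Ω k` (fewer bonds; F0a `lamBondsSeq_subset_bondsDet`). [cite: Balaban1985Variational, (14) p.280; Balaban1984PropagatorsII, (2.3) p.224; Balaban1987RG1, (0.1) p.251] -/
theorem approxMinTopB_lamBondsSeq_of_approxMinTop {av : ∀ j, Averaging P j (SU N)} {Ω : ℕ → Set (Site P 0)} {Ω₀ : Set (Site P 0)} {k : ℕ} {ρ : ℕ → ℝ}
    {W : MSField P (SU N)} {U₀ : GaugeField P 0 (SU N)} (h : B11Thm1ExistsUniqueStepTokensG.ApproxMinTop av Ω Ω₀ k ρ W U₀) :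
    ApproxMinTopB av Ω Ω₀ k ρ (lamBondsSeq Ω k) W U₀ :=
  ((approxMinTop_iff_B av Ω Ω₀ k ρ W U₀).1 h).anti (lamBondsSeq_subset_bondsDet Ω k)

end Approx

/-! ## §2  The reductions over `(bd, Dat)` and the bookkeeping -/

section Reductions

variable {F : T4Family} {N : ℕ} [NeZero N]
variable {Sup : (ν : Stage7Numerics) → (K : ℕ) → (ℕ → Set (Site (F.P K) 0)) → Set (Site (F.P K) 0)} {Adm Adm' : StepGuard F} {bd : BondDatum F} {Dat Dat' : TopData F N}
  {C₁ C₁' B₃ a₀ a₀' a₁ a₁' : ℝ}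

/-- **★★ THE (E∕U) NAMED FACT OVER `(bd, Dat)` FROM THE ONE-LENGTH STEP AND THE SUPPLY OF AN APPROXIMATE MINIMISER** — print's proof of Theorem 1 (existence ∕ uniqueness half) in one
line: at each `(s, W)` take the approximate minimiser the supply token provides and apply the step token to it. [cite: Balaban1985Variational, Thm 1 p.279, (14) p.280, Prop. 2 p.281, (141)–(142) p.299] -/
theorem variationalThm1EUSepTop7MGB_of_step_of_approxExists (hstep : VariationalThm1EUStepTop7MGB F N Sup Adm bd Dat C₁ B₃ a₀ a₁)
    (hsup : ApproxMinimiserExistsTop7MGB F N Sup Adm bd Dat C₁ B₃ a₀ a₁) : VariationalThm1EUSepTop7MGB F N Sup Adm bd Dat B₃ a₀ a₁ := by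
  intro ν M g K k s hk hsep hM₁ hAdm ε₀ δ hnum hc hc' hε W h7
  obtain ⟨U₀, hU₀⟩ := hsup ν M g K k s hk hsep hM₁ hAdm ε₀ δ hnum hc hc' hε W h7
  exact hstep ν M g K k s hk hsep hM₁ hAdm ε₀ δ hnum hc hc' hε W h7 U₀ hU₀

/-- **★★ `CoP` EDITION OVER `(bd, Dat)`**: the (E∕U) name at node00-def-R's selector from the `CoP` step token and the `CoP` supply token.
[cite: Balaban1985Variational, Thm 1 p.279, (14) p.280, Prop. 2 p.281; Balaban1988Convergent, (2.12) p.256] -/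
theorem variationalThm1EUSepCoP7MGB_of_step_of_approxExists (hstep : VariationalThm1EUStepCoP7MGB F N Adm bd Dat C₁ B₃ a₀ a₁)
    (hsup : ApproxMinimiserExistsCoP7MGB F N Adm bd Dat C₁ B₃ a₀ a₁) : VariationalThm1EUSepCoP7MGB F N Adm bd Dat B₃ a₀ a₁ :=
  variationalThm1EUSepTop7MGB_of_step_of_approxExists hstep hsup

/-- **★ THE SUPPLY TOKEN FROM THE NAME AND K0's (R)-NAME, OVER `(bd, Dat)`** (the converse bookkeeping): if minimisers exist (the (E∕U) name) and are `B₃δ_n`-regular (S1a-C's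
`Node00.VariationalThm1RegSepTop7MGB` at the same `(Sup, Adm, bd, Dat)`), then a minimiser itself is an approximate minimiser with (14) at every `C₁ ≥ 1` (`0 ≤ B₃`).
[cite: Balaban1985Variational, Thm 1 (8) p.279, (13)–(14) p.280; Balaban1988Convergent, (2.12) p.256] -/
theorem approxMinimiserExistsTop7MGB_of_eu_of_reg (hEU : VariationalThm1EUSepTop7MGB F N Sup Adm bd Dat B₃ a₀ a₁)
    (hR : VariationalThm1RegSepTop7MGB F N Sup Adm bd Dat B₃ a₀ a₁) (hB₃ : 0 ≤ B₃) (hC₁ : 1 ≤ C₁) : ApproxMinimiserExistsTop7MGB F N Sup Adm bd Dat C₁ B₃ a₀ a₁ := by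
  intro ν M g K k s hk hsep hM₁ hAdm ε₀ δ hnum hc hc' hε W h7
  obtain ⟨⟨U₀, hU₀⟩, -⟩ := hEU ν M g K k s hk hsep hM₁ hAdm ε₀ δ hnum hc hc' hε W h7
  have h8 := hR ν M g K k s hsep hM₁ hAdm ε₀ δ hnum hc hc' hε W h7 U₀ hU₀
  refine ⟨U₀, approxMinTopB_of_reg hU₀.2.1 h8 fun n hn => ?_⟩
  have hδ : 0 ≤ δ n := (hnum n hn).1.le
  calc B₃ * δ n = 1 * (B₃ * δ n) := (one_mul _).symm
    _ ≤ C₁ * (B₃ * δ n) := mul_le_mul_of_nonneg_right hC₁ (mul_nonneg hB₃ hδ)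
    _ = C₁ * B₃ * δ n := (mul_assoc _ _ _).symm

/-- `CoP` edition of the converse bookkeeping, over `(bd, Dat)`. [cite: Balaban1985Variational, Thm 1 (8) p.279, (13)–(14) p.280; Balaban1988Convergent, (2.12) p.256] -/
theorem approxMinimiserExistsCoP7MGB_of_eu_of_reg (hEU : VariationalThm1EUSepCoP7MGB F N Adm bd Dat B₃ a₀ a₁) (hR : VariationalThm1RegSepCoP7MGB F N Adm bd Dat B₃ a₀ a₁)
    (hB₃ : 0 ≤ B₃) (hC₁ : 1 ≤ C₁) : ApproxMinimiserExistsCoP7MGB F N Adm bd Dat C₁ B₃ a₀ a₁ :=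
  approxMinimiserExistsTop7MGB_of_eu_of_reg hEU hR hB₃ hC₁

/-- **★ MODULO THE STEP TOKEN AND (R), THE (E∕U) NAME ⟺ THE SUPPLY TOKEN, OVER `(bd, Dat)`** (`C₁ ≥ 1`, `0 ≤ B₃`). [cite: Balaban1985Variational, Thm 1 p.279, (11) p.279, (12)–(14) p.280, Prop. 2 p.281] -/
theorem variationalThm1EUSepTop7MGB_iff_approxExists_of_step_of_reg (hstep : VariationalThm1EUStepTop7MGB F N Sup Adm bd Dat C₁ B₃ a₀ a₁)
    (hR : VariationalThm1RegSepTop7MGB F N Sup Adm bd Dat B₃ a₀ a₁) (hB₃ : 0 ≤ B₃) (hC₁ : 1 ≤ C₁) :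
    VariationalThm1EUSepTop7MGB F N Sup Adm bd Dat B₃ a₀ a₁ ↔ ApproxMinimiserExistsTop7MGB F N Sup Adm bd Dat C₁ B₃ a₀ a₁ :=
  ⟨fun hEU => approxMinimiserExistsTop7MGB_of_eu_of_reg hEU hR hB₃ hC₁, fun hsup => variationalThm1EUSepTop7MGB_of_step_of_approxExists hstep hsup⟩

/-- `CoP` edition of the equivalence, over `(bd, Dat)`. [cite: Balaban1985Variational, Thm 1 p.279, (11)–(14) pp.279–280; Balaban1988Convergent, (2.12) p.256] -/
theorem variationalThm1EUSepCoP7MGB_iff_approxExists_of_step_of_reg (hstep : VariationalThm1EUStepCoP7MGB F N Adm bd Dat C₁ B₃ a₀ a₁)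
    (hR : VariationalThm1RegSepCoP7MGB F N Adm bd Dat B₃ a₀ a₁) (hB₃ : 0 ≤ B₃) (hC₁ : 1 ≤ C₁) :
    VariationalThm1EUSepCoP7MGB F N Adm bd Dat B₃ a₀ a₁ ↔ ApproxMinimiserExistsCoP7MGB F N Adm bd Dat C₁ B₃ a₀ a₁ :=
  variationalThm1EUSepTop7MGB_iff_approxExists_of_step_of_reg hstep hR hB₃ hC₁

/-! ### bookkeeping for the name: selector, ceilings, guard, data predicate -/

/-- Definitional bridge (`CoP` ⇒ `Top` at the selector of record). [cite: Balaban1985Variational, Thm 1 p.279 (bookkeeping)] -/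
theorem VariationalThm1EUSepCoP7MGB.toTop7MGB (h : VariationalThm1EUSepCoP7MGB F N Adm bd Dat B₃ a₀ a₁) :
    VariationalThm1EUSepTop7MGB F N (fun ν K Ω => suppDomOfRecord F ν K Ω) Adm bd Dat B₃ a₀ a₁ := h

/-- Conversely (definitional). [cite: Balaban1985Variational, Thm 1 p.279 (bookkeeping)] -/
theorem VariationalThm1EUSepTop7MGB.toCoP7MGB (h : VariationalThm1EUSepTop7MGB F N (fun ν K Ω => suppDomOfRecord F ν K Ω) Adm bd Dat B₃ a₀ a₁) :
    VariationalThm1EUSepCoP7MGB F N Adm bd Dat B₃ a₀ a₁ := h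

/-- The name is antitone in the ceilings `a₀ a₁`. [cite: Balaban1985Variational, Thm 1 p.279 (the range «ε₀ ≤ a₀», «ε₁ ≤ a₁»; bookkeeping)] -/
theorem VariationalThm1EUSepTop7MGB.of_le (h : VariationalThm1EUSepTop7MGB F N Sup Adm bd Dat B₃ a₀ a₁) (ha₀ : a₀' ≤ a₀) (ha₁ : a₁' ≤ a₁) :
    VariationalThm1EUSepTop7MGB F N Sup Adm bd Dat B₃ a₀' a₁' :=
  fun ν M g K k s hk hsep hM₁ hadm ε₀ δ hnum hc hc' hε =>
    h ν M g K k s hk hsep hM₁ hadm ε₀ δ (fun n hn => ⟨(hnum n hn).1, (hnum n hn).2.1.trans ha₁, (hnum n hn).2.2⟩) hc hc' (hε.trans ha₀)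

/-- `CoP`: antitone in the ceilings. [cite: Balaban1985Variational, Thm 1 p.279 (bookkeeping)] -/
theorem VariationalThm1EUSepCoP7MGB.of_le (h : VariationalThm1EUSepCoP7MGB F N Adm bd Dat B₃ a₀ a₁) (ha₀ : a₀' ≤ a₀) (ha₁ : a₁' ≤ a₁) :
    VariationalThm1EUSepCoP7MGB F N Adm bd Dat B₃ a₀' a₁' :=
  VariationalThm1EUSepTop7MGB.of_le h ha₀ ha₁

/-- The name is ANTITONE IN THE GUARD: a stronger guard `Adm′ ⇒ Adm` asks the sentence of fewer indices. [cite: Balaban1985Variational, Thm 1 p.279 (bookkeeping)] -/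
theorem VariationalThm1EUSepTop7MGB.of_imp (h : VariationalThm1EUSepTop7MGB F N Sup Adm bd Dat B₃ a₀ a₁) (himp : ∀ ν M g K k s, Adm' ν M g K k s → Adm ν M g K k s) :
    VariationalThm1EUSepTop7MGB F N Sup Adm' bd Dat B₃ a₀ a₁ :=
  fun ν M g K k s hk hsep hM₁ hadm' => h ν M g K k s hk hsep hM₁ (himp ν M g K k s hadm')

/-- `CoP`: antitone in the guard. [cite: Balaban1985Variational, Thm 1 p.279 (bookkeeping)] -/
theorem VariationalThm1EUSepCoP7MGB.of_imp (h : VariationalThm1EUSepCoP7MGB F N Adm bd Dat B₃ a₀ a₁) (himp : ∀ ν M g K k s, Adm' ν M g K k s → Adm ν M g K k s) :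
    VariationalThm1EUSepCoP7MGB F N Adm' bd Dat B₃ a₀ a₁ :=
  VariationalThm1EUSepTop7MGB.of_imp h himp

/-- The name is ANTITONE IN THE DATA PREDICATE: a WEAKER data hypothesis `Dat′ ⇒ Dat` pointwise gives a STRONGER sentence (the door through which §7′-type bridges
`DataSmall7PTop.toLamTop` act). [cite: Balaban1985Variational, (7) p.278, Thm 1 p.279 (bookkeeping)] -/
theorem VariationalThm1EUSepTop7MGB.of_imp_dat (h : VariationalThm1EUSepTop7MGB F N Sup Adm bd Dat B₃ a₀ a₁)
    (himp : ∀ (K : ℕ) (Ω : ℕ → Set (Site (F.P K) 0)) (Ω₀ : Set (Site (F.P K) 0)) (k : ℕ) (δ : ℕ → ℝ) (W : MSField (F.P K) (SU N)), Dat' K Ω Ω₀ k δ W → Dat K Ω Ω₀ k δ W) :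
    VariationalThm1EUSepTop7MGB F N Sup Adm bd Dat' B₃ a₀ a₁ :=
  fun ν M g K k s hk hsep hM₁ hadm ε₀ δ hnum hc hc' hε W h7 => h ν M g K k s hk hsep hM₁ hadm ε₀ δ hnum hc hc' hε W (himp _ _ _ _ _ _ h7)

/-- `CoP`: antitone in the data predicate. [cite: Balaban1985Variational, (7) p.278, Thm 1 p.279 (bookkeeping)] -/
theorem VariationalThm1EUSepCoP7MGB.of_imp_dat (h : VariationalThm1EUSepCoP7MGB F N Adm bd Dat B₃ a₀ a₁)
    (himp : ∀ (K : ℕ) (Ω : ℕ → Set (Site (F.P K) 0)) (Ω₀ : Set (Site (F.P K) 0)) (k : ℕ) (δ : ℕ → ℝ) (W : MSField (F.P K) (SU N)), Dat' K Ω Ω₀ k δ W → Dat K Ω Ω₀ k δ W) :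
    VariationalThm1EUSepCoP7MGB F N Adm bd Dat' B₃ a₀ a₁ :=
  VariationalThm1EUSepTop7MGB.of_imp_dat h himp

/-! ### bookkeeping for the step token -/

/-- The step token is antitone in the guard. [cite: Balaban1985Variational, Prop. 2 p.281 (bookkeeping)] -/
theorem VariationalThm1EUStepTop7MGB.of_imp (h : VariationalThm1EUStepTop7MGB F N Sup Adm bd Dat C₁ B₃ a₀ a₁) (himp : ∀ ν M g K k s, Adm' ν M g K k s → Adm ν M g K k s) :
    VariationalThm1EUStepTop7MGB F N Sup Adm' bd Dat C₁ B₃ a₀ a₁ :=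
  fun ν M g K k s hk hsep hM₁ hadm' => h ν M g K k s hk hsep hM₁ (himp ν M g K k s hadm')

/-- `CoP`: the step token is antitone in the guard. [cite: Balaban1985Variational, Prop. 2 p.281 (bookkeeping)] -/
theorem VariationalThm1EUStepCoP7MGB.of_imp (h : VariationalThm1EUStepCoP7MGB F N Adm bd Dat C₁ B₃ a₀ a₁) (himp : ∀ ν M g K k s, Adm' ν M g K k s → Adm ν M g K k s) :
    VariationalThm1EUStepCoP7MGB F N Adm' bd Dat C₁ B₃ a₀ a₁ :=
  VariationalThm1EUStepTop7MGB.of_imp h himp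

/-- The step token is antitone in the ceilings `a₀ a₁`. [cite: Balaban1985Variational, Thm 1 p.279 (bookkeeping)] -/
theorem VariationalThm1EUStepTop7MGB.of_le (h : VariationalThm1EUStepTop7MGB F N Sup Adm bd Dat C₁ B₃ a₀ a₁) (ha₀ : a₀' ≤ a₀) (ha₁ : a₁' ≤ a₁) :
    VariationalThm1EUStepTop7MGB F N Sup Adm bd Dat C₁ B₃ a₀' a₁' :=
  fun ν M g K k s hk hsep hM₁ hadm ε₀ δ hnum hc hc' hε =>
    h ν M g K k s hk hsep hM₁ hadm ε₀ δ (fun n hn => ⟨(hnum n hn).1, (hnum n hn).2.1.trans ha₁, (hnum n hn).2.2⟩) hc hc' (hε.trans ha₀)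

/-- `CoP`: the step token is antitone in the ceilings. [cite: Balaban1985Variational, Thm 1 p.279 (bookkeeping)] -/
theorem VariationalThm1EUStepCoP7MGB.of_le (h : VariationalThm1EUStepCoP7MGB F N Adm bd Dat C₁ B₃ a₀ a₁) (ha₀ : a₀' ≤ a₀) (ha₁ : a₁' ≤ a₁) :
    VariationalThm1EUStepCoP7MGB F N Adm bd Dat C₁ B₃ a₀' a₁' :=
  VariationalThm1EUStepTop7MGB.of_le h ha₀ ha₁

/-- The step token is antitone in the data predicate. [cite: Balaban1985Variational, (7) p.278, Prop. 2 p.281 (bookkeeping)] -/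
theorem VariationalThm1EUStepTop7MGB.of_imp_dat (h : VariationalThm1EUStepTop7MGB F N Sup Adm bd Dat C₁ B₃ a₀ a₁)
    (himp : ∀ (K : ℕ) (Ω : ℕ → Set (Site (F.P K) 0)) (Ω₀ : Set (Site (F.P K) 0)) (k : ℕ) (δ : ℕ → ℝ) (W : MSField (F.P K) (SU N)), Dat' K Ω Ω₀ k δ W → Dat K Ω Ω₀ k δ W) :
    VariationalThm1EUStepTop7MGB F N Sup Adm bd Dat' C₁ B₃ a₀ a₁ :=
  fun ν M g K k s hk hsep hM₁ hadm ε₀ δ hnum hc hc' hε W h7 => h ν M g K k s hk hsep hM₁ hadm ε₀ δ hnum hc hc' hε W (himp _ _ _ _ _ _ h7)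

/-- `CoP`: the step token is antitone in the data predicate. [cite: Balaban1985Variational, (7) p.278, Prop. 2 p.281 (bookkeeping)] -/
theorem VariationalThm1EUStepCoP7MGB.of_imp_dat (h : VariationalThm1EUStepCoP7MGB F N Adm bd Dat C₁ B₃ a₀ a₁)
    (himp : ∀ (K : ℕ) (Ω : ℕ → Set (Site (F.P K) 0)) (Ω₀ : Set (Site (F.P K) 0)) (k : ℕ) (δ : ℕ → ℝ) (W : MSField (F.P K) (SU N)), Dat' K Ω Ω₀ k δ W → Dat K Ω Ω₀ k δ W) :
    VariationalThm1EUStepCoP7MGB F N Adm bd Dat' C₁ B₃ a₀ a₁ :=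
  VariationalThm1EUStepTop7MGB.of_imp_dat h himp

/-- The step token is ANTITONE IN `C₁` (a larger `C₁` admits more approximate minimisers; `0 ≤ B₃`). [cite: Balaban1985Variational, (14) p.280 (bookkeeping)] -/
theorem VariationalThm1EUStepTop7MGB.of_C₁_le (h : VariationalThm1EUStepTop7MGB F N Sup Adm bd Dat C₁ B₃ a₀ a₁) (hB₃ : 0 ≤ B₃) (hC : C₁' ≤ C₁) :
    VariationalThm1EUStepTop7MGB F N Sup Adm bd Dat C₁' B₃ a₀ a₁ :=
  fun ν M g K k s hk hsep hM₁ hadm ε₀ δ hnum hc hc' hε W h7 U₀ hU₀ =>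
    h ν M g K k s hk hsep hM₁ hadm ε₀ δ hnum hc hc' hε W h7 U₀
      (hU₀.of_le fun n hn => by
        have hδ : 0 ≤ δ n := (hnum n hn).1.le
        calc C₁' * B₃ * δ n = C₁' * (B₃ * δ n) := mul_assoc _ _ _
          _ ≤ C₁ * (B₃ * δ n) := mul_le_mul_of_nonneg_right hC (mul_nonneg hB₃ hδ)
          _ = C₁ * B₃ * δ n := (mul_assoc _ _ _).symm)

/-- `CoP`: antitone in `C₁`. [cite: Balaban1985Variational, (14) p.280 (bookkeeping)] -/
theorem VariationalThm1EUStepCoP7MGB.of_C₁_le (h : VariationalThm1EUStepCoP7MGB F N Adm bd Dat C₁ B₃ a₀ a₁) (hB₃ : 0 ≤ B₃) (hC : C₁' ≤ C₁) :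
    VariationalThm1EUStepCoP7MGB F N Adm bd Dat C₁' B₃ a₀ a₁ :=
  VariationalThm1EUStepTop7MGB.of_C₁_le h hB₃ hC

/-! ### bookkeeping for the supply token -/

/-- The supply token is MONOTONE IN `C₁` (`0 ≤ B₃`). [cite: Balaban1985Variational, (14) p.280 (bookkeeping)] -/
theorem ApproxMinimiserExistsTop7MGB.mono (h : ApproxMinimiserExistsTop7MGB F N Sup Adm bd Dat C₁ B₃ a₀ a₁) (hB₃ : 0 ≤ B₃) (hC : C₁ ≤ C₁') :
    ApproxMinimiserExistsTop7MGB F N Sup Adm bd Dat C₁' B₃ a₀ a₁ := by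
  intro ν M g K k s hk hsep hM₁ hadm ε₀ δ hnum hc hc' hε W h7
  obtain ⟨U₀, hU₀⟩ := h ν M g K k s hk hsep hM₁ hadm ε₀ δ hnum hc hc' hε W h7
  refine ⟨U₀, hU₀.of_le fun n hn => ?_⟩
  have hδ : 0 ≤ δ n := (hnum n hn).1.le
  calc C₁ * B₃ * δ n = C₁ * (B₃ * δ n) := mul_assoc _ _ _
    _ ≤ C₁' * (B₃ * δ n) := mul_le_mul_of_nonneg_right hC (mul_nonneg hB₃ hδ)
    _ = C₁' * B₃ * δ n := (mul_assoc _ _ _).symm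

/-- `CoP`: the supply token is monotone in `C₁`. [cite: Balaban1985Variational, (14) p.280 (bookkeeping)] -/
theorem ApproxMinimiserExistsCoP7MGB.mono (h : ApproxMinimiserExistsCoP7MGB F N Adm bd Dat C₁ B₃ a₀ a₁) (hB₃ : 0 ≤ B₃) (hC : C₁ ≤ C₁') :
    ApproxMinimiserExistsCoP7MGB F N Adm bd Dat C₁' B₃ a₀ a₁ :=
  ApproxMinimiserExistsTop7MGB.mono h hB₃ hC

/-- The supply token is antitone in the guard. [cite: Balaban1985Variational, (14) p.280 (bookkeeping)] -/
theorem ApproxMinimiserExistsTop7MGB.of_imp (h : ApproxMinimiserExistsTop7MGB F N Sup Adm bd Dat C₁ B₃ a₀ a₁) (himp : ∀ ν M g K k s, Adm' ν M g K k s → Adm ν M g K k s) :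
    ApproxMinimiserExistsTop7MGB F N Sup Adm' bd Dat C₁ B₃ a₀ a₁ :=
  fun ν M g K k s hk hsep hM₁ hadm' => h ν M g K k s hk hsep hM₁ (himp ν M g K k s hadm')

/-- `CoP`: the supply token is antitone in the guard. [cite: Balaban1985Variational, (14) p.280 (bookkeeping)] -/
theorem ApproxMinimiserExistsCoP7MGB.of_imp (h : ApproxMinimiserExistsCoP7MGB F N Adm bd Dat C₁ B₃ a₀ a₁) (himp : ∀ ν M g K k s, Adm' ν M g K k s → Adm ν M g K k s) :
    ApproxMinimiserExistsCoP7MGB F N Adm' bd Dat C₁ B₃ a₀ a₁ :=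
  ApproxMinimiserExistsTop7MGB.of_imp h himp

/-- The supply token is antitone in the data predicate. [cite: Balaban1985Variational, (7) p.278, (14) p.280 (bookkeeping)] -/
theorem ApproxMinimiserExistsTop7MGB.of_imp_dat (h : ApproxMinimiserExistsTop7MGB F N Sup Adm bd Dat C₁ B₃ a₀ a₁)
    (himp : ∀ (K : ℕ) (Ω : ℕ → Set (Site (F.P K) 0)) (Ω₀ : Set (Site (F.P K) 0)) (k : ℕ) (δ : ℕ → ℝ) (W : MSField (F.P K) (SU N)), Dat' K Ω Ω₀ k δ W → Dat K Ω Ω₀ k δ W) :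
    ApproxMinimiserExistsTop7MGB F N Sup Adm bd Dat' C₁ B₃ a₀ a₁ :=
  fun ν M g K k s hk hsep hM₁ hadm ε₀ δ hnum hc hc' hε W h7 => h ν M g K k s hk hsep hM₁ hadm ε₀ δ hnum hc hc' hε W (himp _ _ _ _ _ _ h7)

/-- `CoP`: the supply token is antitone in the data predicate. [cite: Balaban1985Variational, (7) p.278, (14) p.280 (bookkeeping)] -/
theorem ApproxMinimiserExistsCoP7MGB.of_imp_dat (h : ApproxMinimiserExistsCoP7MGB F N Adm bd Dat C₁ B₃ a₀ a₁)
    (himp : ∀ (K : ℕ) (Ω : ℕ → Set (Site (F.P K) 0)) (Ω₀ : Set (Site (F.P K) 0)) (k : ℕ) (δ : ℕ → ℝ) (W : MSField (F.P K) (SU N)), Dat' K Ω Ω₀ k δ W → Dat K Ω Ω₀ k δ W) :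
    ApproxMinimiserExistsCoP7MGB F N Adm bd Dat' C₁ B₃ a₀ a₁ :=
  ApproxMinimiserExistsTop7MGB.of_imp_dat h himp

/-- The supply token is antitone in the ceilings. [cite: Balaban1985Variational, Thm 1 p.279 (bookkeeping)] -/
theorem ApproxMinimiserExistsTop7MGB.of_le (h : ApproxMinimiserExistsTop7MGB F N Sup Adm bd Dat C₁ B₃ a₀ a₁) (ha₀ : a₀' ≤ a₀) (ha₁ : a₁' ≤ a₁) :
    ApproxMinimiserExistsTop7MGB F N Sup Adm bd Dat C₁ B₃ a₀' a₁' :=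
  fun ν M g K k s hk hsep hM₁ hadm ε₀ δ hnum hc hc' hε =>
    h ν M g K k s hk hsep hM₁ hadm ε₀ δ (fun n hn => ⟨(hnum n hn).1, (hnum n hn).2.1.trans ha₁, (hnum n hn).2.2⟩) hc hc' (hε.trans ha₀)

/-- `CoP`: the supply token is antitone in the ceilings. [cite: Balaban1985Variational, Thm 1 p.279 (bookkeeping)] -/
theorem ApproxMinimiserExistsCoP7MGB.of_le (h : ApproxMinimiserExistsCoP7MGB F N Adm bd Dat C₁ B₃ a₀ a₁) (ha₀ : a₀' ≤ a₀) (ha₁ : a₁' ≤ a₁) :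
    ApproxMinimiserExistsCoP7MGB F N Adm bd Dat C₁ B₃ a₀' a₁' :=
  ApproxMinimiserExistsTop7MGB.of_le h ha₀ ha₁

/-! ### bookkeeping for the lift token -/

/-- The lift token is antitone in the guard AT LENGTH `k + 1` (the guard is read at the untruncated index only). [cite: Balaban1985Variational, (11) p.279 (bookkeeping)] -/
theorem VariationalThm1EULiftTop7MGB.of_imp (h : VariationalThm1EULiftTop7MGB F N Sup Adm bd Dat C₁ B₃ a₀ a₁) (himp : ∀ ν M g K k s, Adm' ν M g K k s → Adm ν M g K k s) :
    VariationalThm1EULiftTop7MGB F N Sup Adm' bd Dat C₁ B₃ a₀ a₁ :=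
  fun ν M g K k s hk hsep hM₁ hadm' => h ν M g K k s hk hsep hM₁ (himp ν M g K (k + 1) s hadm')

/-- `CoP`: the lift token is antitone in the guard. [cite: Balaban1985Variational, (11) p.279 (bookkeeping)] -/
theorem VariationalThm1EULiftCoP7MGB.of_imp (h : VariationalThm1EULiftCoP7MGB F N Adm bd Dat C₁ B₃ a₀ a₁) (himp : ∀ ν M g K k s, Adm' ν M g K k s → Adm ν M g K k s) :
    VariationalThm1EULiftCoP7MGB F N Adm' bd Dat C₁ B₃ a₀ a₁ :=
  VariationalThm1EULiftTop7MGB.of_imp h himp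

/-- The lift token is MONOTONE IN `C₁` (its conclusion is (14) at `C₁B₃δ`; `0 ≤ B₃`). [cite: Balaban1985Variational, (13)–(14) p.280 (bookkeeping)] -/
theorem VariationalThm1EULiftTop7MGB.mono (h : VariationalThm1EULiftTop7MGB F N Sup Adm bd Dat C₁ B₃ a₀ a₁) (hB₃ : 0 ≤ B₃) (hC : C₁ ≤ C₁') :
    VariationalThm1EULiftTop7MGB F N Sup Adm bd Dat C₁' B₃ a₀ a₁ := by
  intro ν M g K k s hk hsep hM₁ hadm ε₀ δ hnum hc hc' hε W h7
  obtain ⟨ε₀', δ', V₀, hnum', hcm', hcm'', hε', h7', himp⟩ := h ν M g K k s hk hsep hM₁ hadm ε₀ δ hnum hc hc' hε W h7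
  refine ⟨ε₀', δ', V₀, hnum', hcm', hcm'', hε', h7', fun U hU h8 => (himp U hU h8).of_le fun n hn => ?_⟩
  have hδ : 0 ≤ δ n := (hnum n hn).1.le
  calc C₁ * B₃ * δ n = C₁ * (B₃ * δ n) := mul_assoc _ _ _
    _ ≤ C₁' * (B₃ * δ n) := mul_le_mul_of_nonneg_right hC (mul_nonneg hB₃ hδ)
    _ = C₁' * B₃ * δ n := (mul_assoc _ _ _).symm

/-- `CoP`: the lift token is monotone in `C₁`. [cite: Balaban1985Variational, (13)–(14) p.280 (bookkeeping)] -/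
theorem VariationalThm1EULiftCoP7MGB.mono (h : VariationalThm1EULiftCoP7MGB F N Adm bd Dat C₁ B₃ a₀ a₁) (hB₃ : 0 ≤ B₃) (hC : C₁ ≤ C₁') :
    VariationalThm1EULiftCoP7MGB F N Adm bd Dat C₁' B₃ a₀ a₁ :=
  VariationalThm1EULiftTop7MGB.mono h hB₃ hC

end Reductions

/-! ## §3  Print's induction over `(bd, Dat)`, proved -/

section Induction

variable {F : T4Family} {N : ℕ} [NeZero N]
variable {Sup : (ν : Stage7Numerics) → (K : ℕ) → (ℕ → Set (Site (F.P K) 0)) → Set (Site (F.P K) 0)} {Adm : StepGuard F} {bd : BondDatum F} {Dat : TopData F N}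
  {C₁ B₃ a₀ a₁ : ℝ}

/-- **★★★ [15] THEOREM 1 (E∕U) BY INDUCTION ON THE LENGTH, OVER A BOND DATUM AND A TOP-DATA PREDICATE — print's proof architecture, kernel-checked**: the (E∕U) named fact
`VariationalThm1EUSepTop7MGB F N Sup Adm bd Dat B₃ a₀ a₁` follows from (i) the ONE-LENGTH STEP token over `(bd, Dat)` ([15] Prop. 2 + Sects. B–E given an approximate minimiser with
(14) at `C₁B₃δ`), (ii) K0's (R)-name over `(bd, Dat)` (S1a-C `Node00.VariationalThm1RegSepTop7MGB`: minimisers are `B₃δ`-regular), (iii) the supply of an approximate minimiser AT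
LENGTH 1 ONLY — the supply token under the guard `Adm ∧ (k = 1)` (*«for k = 1 we do not have any solutions of the variational problem yet, and then we take simply U₀ = V₀»*), (iv) the
LIFT token (11)–(13) over `(bd, Dat)`, (v) truncation-stability of the guard.  Proof = print's (and `B11Thm1ExistsUniqueInductionGBridges`' verbatim): induction on `k`; at `k + 1 ≥ 2`
the lift supplies `(ε₀′, δ′, V₀)` for the truncated problem, the induction hypothesis a minimiser `U₀ = U_k(V₀)` there ((12)), (R) its regularity, the lift (13) = (14) at length
`k+1`, and the step token concludes.  At print's datum `(lamDatum F, dataSmall7LamTopOf F N)` this is Theorem 1's own decomposition with no interface-solvability artefact.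
[cite: Balaban1985Variational, Thm 1 p.279, (11) p.279, (12)–(14) p.280, Prop. 2 p.281, (141)–(142) p.299; Balaban1984PropagatorsII, (2.3) p.224] -/
theorem variationalThm1EUSepTop7MGB_of_step_of_reg_of_base_of_lift (hstep : VariationalThm1EUStepTop7MGB F N Sup Adm bd Dat C₁ B₃ a₀ a₁)
    (hR : VariationalThm1RegSepTop7MGB F N Sup Adm bd Dat B₃ a₀ a₁)
    (hbase : ApproxMinimiserExistsTop7MGB F N Sup (fun ν M g K k s => Adm ν M g K k s ∧ k = 1) bd Dat C₁ B₃ a₀ a₁)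
    (hlift : VariationalThm1EULiftTop7MGB F N Sup Adm bd Dat C₁ B₃ a₀ a₁)
    (hAdm : ∀ ν M g K k (s : SeqOfRecord F ν M g K (k + 1)), 0 < k → Adm ν M g K (k + 1) s → Adm ν M g K k (truncSeq s)) :
    VariationalThm1EUSepTop7MGB F N Sup Adm bd Dat B₃ a₀ a₁ := by
  intro ν M g K k
  induction k with
  | zero => intro s hk; exact absurd hk (lt_irrefl 0)
  | succ k ih =>
    intro s hk hsep hM₁ hadm ε₀ δ hnum hc hc' hε W h7
    rcases Nat.eq_zero_or_pos k with hk0 | hk0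
    · -- length `1`: the supply token at length `1` gives `U₀` ((11): `U₀ = V₀`), the step token concludes
      subst hk0
      obtain ⟨U₀, hU₀⟩ := hbase ν M g K 1 s hk hsep hM₁ ⟨hadm, rfl⟩ ε₀ δ hnum hc hc' hε W h7
      exact hstep ν M g K 1 s hk hsep hM₁ hadm ε₀ δ hnum hc hc' hε W h7 U₀ hU₀
    · -- length `k + 1 ≥ 2`: lift, induction hypothesis on the truncated problem, (R), step
      obtain ⟨ε₀', δ', V₀, hnum', hcm', hcm'', hε', h7', himp⟩ := hlift ν M g K k s hk0 hsep hM₁ hadm ε₀ δ hnum hc hc' hε W h7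
      have hsep' : Sect2.SeqSeparated ν.M₁ (truncSeq s) := seqSeparated_truncSeq s hsep
      have hadm' : Adm ν M g K k (truncSeq s) := hAdm ν M g K k s hk0 hadm
      obtain ⟨⟨U₀, hU₀⟩, -⟩ := ih (truncSeq s) hk0 hsep' hM₁ hadm' ε₀' δ' hnum' hcm' hcm'' hε' V₀ h7'
      have h8 := hR ν M g K k (truncSeq s) hsep' hM₁ hadm' ε₀' δ' hnum' hcm' hcm'' hε' V₀ h7' U₀ hU₀
      exact hstep ν M g K (k + 1) s hk hsep hM₁ hadm ε₀ δ hnum hc hc' hε W h7 U₀ (himp U₀ hU₀ h8)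

/-- **★★★ `CoP` EDITION — [15] THEOREM 1 (E∕U) BY INDUCTION ON THE LENGTH, OVER `(bd, Dat)`, ON THE SUPPORT OF RECORD**: the (E∕U) name `VariationalThm1EUSepCoP7MGB F N Adm bd Dat B₃
a₀ a₁` from the `CoP` step token, K0's `Node00.VariationalThm1RegSepCoP7MGB`, the `CoP` supply token at length `1`, the `CoP` lift token and truncation-stability of the guard.
[cite: Balaban1985Variational, Thm 1 p.279, (11)–(14) pp.279–280, Prop. 2 p.281; Balaban1988Convergent, (2.12) p.256; Balaban1984PropagatorsII, (2.3) p.224] -/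
theorem variationalThm1EUSepCoP7MGB_of_step_of_reg_of_base_of_lift (hstep : VariationalThm1EUStepCoP7MGB F N Adm bd Dat C₁ B₃ a₀ a₁)
    (hR : VariationalThm1RegSepCoP7MGB F N Adm bd Dat B₃ a₀ a₁)
    (hbase : ApproxMinimiserExistsCoP7MGB F N (fun ν M g K k s => Adm ν M g K k s ∧ k = 1) bd Dat C₁ B₃ a₀ a₁)
    (hlift : VariationalThm1EULiftCoP7MGB F N Adm bd Dat C₁ B₃ a₀ a₁)
    (hAdm : ∀ ν M g K k (s : SeqOfRecord F ν M g K (k + 1)), 0 < k → Adm ν M g K (k + 1) s → Adm ν M g K k (truncSeq s)) :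
    VariationalThm1EUSepCoP7MGB F N Adm bd Dat B₃ a₀ a₁ :=
  variationalThm1EUSepTop7MGB_of_step_of_reg_of_base_of_lift hstep hR hbase hlift hAdm

/-- **THE FLOOR-GUARD INSTANCE OVER `(bd, Dat)`** (K0's `floorGuard F c`, truncation-stable for free): (E∕U) under the floor guard from the four tokens under the floor guard.
[cite: Balaban1985Variational, Thm 1 p.279, (11)–(14) pp.279–280; Balaban1985RegularSpaces, (1.3)–(1.6) p.77] -/
theorem variationalThm1EUSepCoP7MGB_floorGuard_of_step_of_reg_of_base_of_lift (c : ℕ) (hstep : VariationalThm1EUStepCoP7MGB F N (floorGuard F c) bd Dat C₁ B₃ a₀ a₁)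
    (hR : VariationalThm1RegSepCoP7MGB F N (floorGuard F c) bd Dat B₃ a₀ a₁)
    (hbase : ApproxMinimiserExistsCoP7MGB F N (fun ν M g K k s => floorGuard F c ν M g K k s ∧ k = 1) bd Dat C₁ B₃ a₀ a₁)
    (hlift : VariationalThm1EULiftCoP7MGB F N (floorGuard F c) bd Dat C₁ B₃ a₀ a₁) :
    VariationalThm1EUSepCoP7MGB F N (floorGuard F c) bd Dat B₃ a₀ a₁ :=
  variationalThm1EUSepCoP7MGB_of_step_of_reg_of_base_of_lift hstep hR hbase hlift fun _ν _M _g _K _k s _ h => floorGuard_truncSeq c _ _ _ _ _ s h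

end Induction

end Literature.MathematicalPhysics.QuantumFieldTheory.Balaban1983to89.B11Thm1ExistsUniqueTokensGB

end
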